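import Literature.Analysis.SpecialFunctions.GammaProductBounds
import Literature.Analysis.Complex.RectangleResidueSimplePoles
import Mathlib.Analysis.MellinInversion
import Mathlib.Analysis.SpecialFunctions.Gamma.Deriv
import Mathlib.NumberTheory.LSeries.Basic
import Mathlib.Analysis.Normed.Module.FiniteDimension
import Mathlib.MeasureTheory.Integral.IntegralEqImproper
import HarnessLib

/-!
# The Cahen–Mellin integral and the heat-kernel representation of a Dirichlet series;
# the residue theorem between two vertical lines

Topic `Literature/Analysis/Complex` (contour integration; continuing `VerticalLineShift.lean`,
`RectangleResidueSimplePoles.lean`, `HorizontalStripResidues.lean`). Everything here is PROVED;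
there are no named facts and no definitions.

* `exp_neg_eq_mellinInv_Gamma` — the **Cahen–Mellin integral**
  `e^{−x} = (1/2πi) ∫_{(c)} Γ(s) x^{−s} ds` (`x > 0`, `0 < c ≤ 2`), i.e. Mellin inversion
  (Mathlib's `mellinInv_mellin_eq`) for `Γ = 𝓜(e^{−x})` (Mathlib's `Complex.GammaIntegral_eq_mellin`),
  the vertical integrability of `Γ` being the tree's
  `Literature.Analysis.SpecialFunctions.integrable_Gamma_vertical`.
* `tsum_mul_exp_neg_eq_integral_LSeries` — for a Dirichlet series `L(s) = ∑ b(n) n^{−s}`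
  absolutely convergent at `re s = c ∈ (0, 2]`, and `w > 0`:
  `∑_{n ≥ 1} b(n) e^{−nw} = (1/2π) ∫ L(c + iy) Γ(c + iy) w^{−(c+iy)} dy`
  (termwise Cahen–Mellin at `x = nw` and `∑ ∫ = ∫ ∑`). This is the classical representation
  behind Landau/Hardy-type uses of the functional equation (e.g. Titchmarsh, *The Theory of the
  Riemann Zeta-Function*, §2.7 for `ζ`; Chandrasekharan–Narasimhan for general Dirichlet series).
* `integral_vertical_sub_eq_sum_of_simplePoles` — the **residue theorem for a vertical strip**
  `a ≤ re s ≤ b` with finitely many simple poles (in the concrete sense `F = φ_p/(z − p)` near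
  `p`) strictly inside, `F` integrable on both lines and uniformly small on the horizontal
  cross-sections: `∫ F(b + iy) dy − ∫ F(a + iy) dy = 2π Σ_p φ_p(p)` (the vertical companion of
  `Literature.Analysis.Complex.integral_horizontal_sub_eq_sum_of_simplePoles`).

## References

* E. C. Titchmarsh, *The Theory of the Riemann Zeta-Function*, 2nd ed. (1986), §2.7, §2.15.
* G. H. Hardy, M. Riesz, *The General Theory of Dirichlet's Series*, Cambridge Tract 18 (1915),
  §6 (Cahen–Mellin / Perron-type integrals).
* J. B. Conway, *Functions of One Complex Variable I*, 2nd ed., Ch. V §2 (residue theorem).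
-/

noncomputable section

open _root_.Complex Set MeasureTheory Filter intervalIntegral Real
open scoped _root_.Topology

namespace Literature.Analysis.Complex

/-! ### The residue theorem between two vertical lines -/

/-- **Residue theorem for a vertical strip.** Let `a < b`, `U ⊇ {a ≤ re w ≤ b}` open,
`S` a finite set of points of the open strip, `F` complex differentiable on `U ∖ S` with a simple
pole at each `p ∈ S` in the concrete sense `F(z) = φ_p(z)/(z − p)` near `p` (`φ_p` differentiable
near `p`, `φ_p(p) = r(p)`). If `F` is integrable along `re w = a` and `re w = b` and
`sup_{x ∈ [a,b]} ‖F(x + Ti)‖ → 0` as `|T| → ∞`, then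
`∫ F(b + yi) dy − ∫ F(a + yi) dy = 2π Σ_{p ∈ S} r(p)` (right line minus left line:
`(1/2πi)(∫_{(b)} − ∫_{(a)}) F = Σ res`). [folklore] -/
theorem integral_vertical_sub_eq_sum_of_simplePoles {F : ℂ → ℂ} {a b : ℝ} (hab : a < b)
    (S : Finset ℂ) (r : ℂ → ℂ) (U : Set ℂ) (hU : IsOpen U)
    (hKU : re ⁻¹' Icc a b ⊆ U) (hS : ∀ p ∈ S, p.re ∈ Ioo a b)
    (hF : DifferentiableOn ℂ F (U \ ↑S))
    (hpole : ∀ p ∈ S, ∃ φ : ℂ → ℂ, ∃ V ∈ 𝓝 p, DifferentiableOn ℂ φ V ∧ φ p = r p ∧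
        ∀ z ∈ V, z ≠ p → F z = φ z / (z - p))
    (ha : Integrable fun y : ℝ ↦ F (a + y * I)) (hb : Integrable fun y : ℝ ↦ F (b + y * I))
    (hdecay : ∀ ε : ℝ, 0 < ε → ∃ T₀ : ℝ, ∀ T : ℝ, T₀ ≤ |T| → ∀ x ∈ Icc a b,
        ‖F (x + T * I)‖ ≤ ε) :
    (∫ y : ℝ, F (b + y * I)) - ∫ y : ℝ, F (a + y * I) = 2 * π * ∑ p ∈ S, r p := by
  classical
  -- all poles have `|im p| < R`
  set R : ℝ := ∑ p ∈ S, |p.im| + 1 with hRdef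
  have hsum0 : 0 ≤ ∑ p ∈ S, |p.im| := Finset.sum_nonneg fun q _ ↦ abs_nonneg _
  have hR0 : 0 < R := by rw [hRdef]; linarith
  have hR : ∀ p ∈ S, |p.im| < R := fun p hp ↦ by
    have : |p.im| ≤ ∑ q ∈ S, |q.im| :=
      Finset.single_le_sum (f := fun q ↦ |q.im|) (fun q _ ↦ abs_nonneg _) hp
    rw [hRdef]; linarith
  -- the rectangle identity for `T ≥ R`
  have hrect : ∀ T : ℝ, R ≤ T →
      rectBoundaryIntegral F a b (-T) T = 2 * π * I * ∑ p ∈ S, r p := by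
    intro T hT
    have hT0 : 0 < T := hR0.trans_le hT
    refine rectBoundaryIntegral_eq_sum_of_simplePoles hab (by linarith) S F r U hU ?_ ?_ hF hpole
    · intro z hz
      rw [mem_reProdIm] at hz
      exact hKU hz.1
    · intro p hp
      rw [mem_reProdIm]
      have h := hR p (by exact_mod_cast hp)
      rw [abs_lt] at h
      exact ⟨hS p (by exact_mod_cast hp), ⟨by linarith, by linarith⟩⟩
  -- the vertical sides converge to the full line integrals
  have hright : Tendsto (fun T : ℝ ↦ ∫ y in (-T)..T, F (b + y * I)) atTop
      (𝓝 (∫ y : ℝ, F (b + y * I))) :=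
    intervalIntegral_tendsto_integral hb tendsto_neg_atTop_atBot tendsto_id
  have hleft : Tendsto (fun T : ℝ ↦ ∫ y in (-T)..T, F (a + y * I)) atTop
      (𝓝 (∫ y : ℝ, F (a + y * I))) :=
    intervalIntegral_tendsto_integral ha tendsto_neg_atTop_atBot tendsto_id
  -- the horizontal sides tend to zero
  have hhor : Tendsto (fun T : ℝ ↦ (∫ x in a..b, F (x + ((-T : ℝ) : ℂ) * I))
      - ∫ x in a..b, F (x + T * I)) atTop (𝓝 0) := by
    rw [Metric.tendsto_atTop]
    intro ε hε
    set ε' : ℝ := ε / (2 * (b - a) + 1) with hε'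
    have hba : 0 ≤ b - a := by linarith
    have hε'0 : 0 < ε' := div_pos hε (by positivity)
    obtain ⟨T₀, hT₀⟩ := hdecay ε' hε'0
    refine ⟨max T₀ 0, fun T hT ↦ ?_⟩
    have hT0 : 0 ≤ T := le_of_max_le_right hT
    have hTabs : T₀ ≤ |T| := by rw [abs_of_nonneg hT0]; exact le_of_max_le_left hT
    have hTabs' : T₀ ≤ |(-T)| := by rwa [abs_neg]
    have htop : ‖∫ x in a..b, F (x + T * I)‖ ≤ ε' * |b - a| :=
      norm_integral_le_of_norm_le_const fun x hx ↦
        hT₀ T hTabs x (by rw [uIoc_of_le hab.le] at hx; exact ⟨hx.1.le, hx.2⟩)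
    have hbot : ‖∫ x in a..b, F (x + ((-T : ℝ) : ℂ) * I)‖ ≤ ε' * |b - a| :=
      norm_integral_le_of_norm_le_const fun x hx ↦
        hT₀ (-T) hTabs' x (by rw [uIoc_of_le hab.le] at hx; exact ⟨hx.1.le, hx.2⟩)
    rw [abs_of_nonneg hba] at htop hbot
    rw [dist_zero_right]
    calc ‖(∫ x in a..b, F (x + ((-T : ℝ) : ℂ) * I)) - ∫ x in a..b, F (x + T * I)‖
        ≤ ε' * (b - a) + ε' * (b - a) := (norm_sub_le _ _).trans (add_le_add hbot htop)
      _ < ε := by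
          have : ε' * (2 * (b - a) + 1) = ε := by rw [hε']; field_simp
          nlinarith
  -- assemble the limit of the rectangle integrals
  have hlim : Tendsto (fun T : ℝ ↦ rectBoundaryIntegral F a b (-T) T) atTop
      (𝓝 (0 + (I * (∫ y : ℝ, F (b + y * I)) - I * ∫ y : ℝ, F (a + y * I)))) := by
    refine (hhor.add ((hright.const_mul I).sub (hleft.const_mul I))).congr'
      (Eventually.of_forall fun T ↦ ?_)
    simp only [rectBoundaryIntegral]
    push_cast
    ring
  have hconst : Tendsto (fun T : ℝ ↦ rectBoundaryIntegral F a b (-T) T) atTop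
      (𝓝 (2 * π * I * ∑ p ∈ S, r p)) := by
    refine tendsto_const_nhds.congr' ?_
    filter_upwards [eventually_ge_atTop R] with T hT
    exact (hrect T hT).symm
  have h := tendsto_nhds_unique hlim hconst
  rw [zero_add, ← mul_sub] at h
  have h2 : I * (((∫ y : ℝ, F (b + y * I)) - (∫ y : ℝ, F (a + y * I))) - 2 * π * ∑ p ∈ S, r p) = 0 := by
    rw [mul_sub, h]; ring
  rcases mul_eq_zero.1 h2 with h3 | h3
  · exact absurd h3 I_ne_zero
  · exact sub_eq_zero.1 h3

/-! ### The Cahen–Mellin integral -/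

/-- **Cahen–Mellin integral**: for `x > 0` and `0 < c ≤ 2`,
`(1/2π) ∫ x^{−(c+iy)} Γ(c+iy) dy = e^{−x}`, i.e. `e^{−x} = (1/2πi)∫_{(c)} Γ(s) x^{−s} ds`
(Mellin inversion for `Γ(s) = ∫₀^∞ e^{−t} t^{s−1} dt`). The restriction `c ≤ 2` only reflects the
range of the tree's integrability lemma for `Γ` on vertical lines. [folklore] -/
theorem exp_neg_eq_mellinInv_Gamma {c : ℝ} (hc : 0 < c) (hc2 : c ≤ 2) {x : ℝ} (hx : 0 < x) :
    (1 / (2 * π) : ℂ) * ∫ y : ℝ, (x : ℂ) ^ (-(c + y * I)) * Complex.Gamma (c + y * I) =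
      Real.exp (-x) := by
  set f : ℝ → ℂ := fun t ↦ (Real.exp (-t) : ℂ) with hf
  have hmel : ∀ y : ℝ, mellin f (c + y * I) = Complex.Gamma (c + y * I) := fun y ↦ by
    rw [hf, ← congrFun Complex.GammaIntegral_eq_mellin, ← Complex.Gamma_eq_integral (by simp [hc])]
  have hconv : MellinConvergent f c := by
    have h := Complex.GammaIntegral_convergent (s := c) (by simp [hc])
    refine (h.congr_fun (fun t _ ↦ ?_) measurableSet_Ioi)
    simp only [hf, smul_eq_mul]
    push_cast
    ring
  have hvert : VerticalIntegrable (mellin f) c := by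
    unfold VerticalIntegrable
    exact (Literature.Analysis.SpecialFunctions.integrable_Gamma_vertical hc hc2).congr
      (Eventually.of_forall fun y ↦ (hmel y).symm)
  have hcont : ContinuousAt f x := by
    have : Continuous f := by rw [hf]; fun_prop
    exact this.continuousAt
  have h := mellinInv_mellin_eq c f hx hconv hvert hcont
  rw [mellinInv, Complex.real_smul] at h
  have key : (1 / (2 * π) : ℂ) * ∫ y : ℝ, (x : ℂ) ^ (-(c + y * I)) * Complex.Gamma (c + y * I) =
      f x := by
    rw [← h]
    push_cast
    congr 1
    refine integral_congr_ae (Eventually.of_forall fun y ↦ ?_)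
    simp only [smul_eq_mul, hmel y]
  rw [key]

/-! ### The heat-kernel representation of a Dirichlet series -/

/-- The terms: for `n ≥ 1`, `w > 0`, `0 < c ≤ 2`,
`b(n) e^{−nw} = (1/2π) ∫ b(n) n^{−(c+iy)} · w^{−(c+iy)} Γ(c+iy) dy`
(Cahen–Mellin at `x = nw` and `(nw)^{−s} = n^{−s} w^{−s}`). [folklore] -/
theorem mul_exp_neg_eq_integral_term (b : ℕ → ℂ) {c : ℝ} (hc : 0 < c) (hc2 : c ≤ 2) {w : ℝ}
    (hw : 0 < w) (n : ℕ) :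
    (if n = 0 then 0 else b n * (Real.exp (-(n * w)) : ℂ)) =
      (1 / (2 * π) : ℂ) * ∫ y : ℝ, LSeries.term b (c + y * I) n *
        ((w : ℂ) ^ (-(c + y * I)) * Complex.Gamma (c + y * I)) := by
  rcases eq_or_ne n 0 with rfl | hn
  · simp
  simp only [hn, if_false]
  have hn0 : (0 : ℝ) < n := by exact_mod_cast Nat.pos_of_ne_zero hn
  have h := exp_neg_eq_mellinInv_Gamma hc hc2 (mul_pos hn0 hw)
  simp_rw [Complex.ofReal_mul] at h
  rw [← h, ← mul_assoc, mul_comm (b n), mul_assoc, ← MeasureTheory.integral_const_mul]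
  congr 1
  refine integral_congr_ae (Eventually.of_forall fun y ↦ ?_)
  simp only
  rw [LSeries.term_of_ne_zero hn, Complex.mul_cpow_ofReal_nonneg hn0.le hw.le, div_eq_mul_inv,
    ← Complex.cpow_neg, Complex.ofReal_natCast]
  ring

/-- **Heat-kernel (Cahen–Mellin) representation of a Dirichlet series.** If `∑ b(n) n^{−s}` is
(absolutely) summable at `re s = c ∈ (0, 2]` and `w > 0`, then
`∑_{n ≥ 1} b(n) e^{−nw} = (1/2π) ∫ L(c+iy) · w^{−(c+iy)} Γ(c+iy) dy`, `L = LSeries b`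
(termwise Cahen–Mellin; the interchange of sum and integral is justified by
`∑ₙ ∫ |b(n)| n^{−c} w^{−c} |Γ(c+iy)| dy < ∞`). [folklore] -/
theorem tsum_mul_exp_neg_eq_integral_LSeries (b : ℕ → ℂ) {c : ℝ} (hc : 0 < c) (hc2 : c ≤ 2)
    (hsum : LSeriesSummable b c) {w : ℝ} (hw : 0 < w) :
    ∑' n : ℕ, (if n = 0 then 0 else b n * (Real.exp (-(n * w)) : ℂ)) =
      (1 / (2 * π) : ℂ) * ∫ y : ℝ, LSeries b (c + y * I) *
        ((w : ℂ) ^ (-(c + y * I)) * Complex.Gamma (c + y * I)) := by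
  have hΓ := Literature.Analysis.SpecialFunctions.integrable_Gamma_vertical hc hc2
  -- the `n`-th integrand and its norm
  set G : ℕ → ℝ → ℂ := fun n y ↦ LSeries.term b (c + y * I) n *
    ((w : ℂ) ^ (-(c + y * I)) * Complex.Gamma (c + y * I)) with hG
  have hnormG : ∀ n y, ‖G n y‖ = ‖LSeries.term b c n‖ * (w ^ (-c) * ‖Complex.Gamma (c + y * I)‖) := by
    intro n y
    simp only [hG, norm_mul]
    rw [Complex.norm_cpow_eq_rpow_re_of_pos hw]
    simp [LSeries.norm_term_eq]
  have hcontw : Continuous fun y : ℝ ↦ (w : ℂ) ^ (-(c + y * I)) :=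
    Continuous.const_cpow (by fun_prop) (Or.inl (by exact_mod_cast hw.ne'))
  have hcontn : ∀ n : ℕ, Continuous fun y : ℝ ↦ LSeries.term b (c + y * I) n := by
    intro n
    rcases eq_or_ne n 0 with rfl | hn
    · simp only [LSeries.term_zero]; exact continuous_const
    · simp only [LSeries.term_of_ne_zero hn, div_eq_mul_inv]
      refine continuous_const.mul (Continuous.inv₀ ?_ fun y ↦ ?_)
      · exact Continuous.const_cpow (by fun_prop) (Or.inl (by exact_mod_cast hn))
      · exact (Complex.cpow_ne_zero_iff_of_exponent_ne_zero (by
          intro h0; have := congrArg Complex.re h0; simp at this; linarith)).2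
          (by exact_mod_cast hn)
  have hint : ∀ n, Integrable (G n) := by
    intro n
    have h := hΓ.bdd_mul (((hcontn n).mul hcontw).aestronglyMeasurable)
      (c := ‖LSeries.term b c n‖ * w ^ (-c)) (Eventually.of_forall fun y ↦ ?_)
    · refine h.congr (Eventually.of_forall fun y ↦ ?_)
      simp only [hG, Pi.mul_apply]; ring
    · simp only [Pi.mul_apply]
      rw [norm_mul, Complex.norm_cpow_eq_rpow_re_of_pos hw]
      simp [LSeries.norm_term_eq]
  have hnormint : ∀ n, ∫ y, ‖G n y‖ = ‖LSeries.term b c n‖ * (w ^ (-c) *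
      ∫ y : ℝ, ‖Complex.Gamma (c + y * I)‖) := by
    intro n
    simp_rw [hnormG]
    rw [MeasureTheory.integral_const_mul, MeasureTheory.integral_const_mul]
  have hsumm : Summable fun n ↦ ∫ y, ‖G n y‖ := by
    simp_rw [hnormint]
    exact (summable_norm_iff.2 hsum).mul_right _
  -- interchange
  calc ∑' n : ℕ, (if n = 0 then 0 else b n * (Real.exp (-(n * w)) : ℂ))
      = ∑' n : ℕ, (1 / (2 * π) : ℂ) * ∫ y : ℝ, G n y :=
        tsum_congr fun n ↦ mul_exp_neg_eq_integral_term b hc hc2 hw n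
    _ = (1 / (2 * π) : ℂ) * ∑' n : ℕ, ∫ y : ℝ, G n y := tsum_mul_left
    _ = (1 / (2 * π) : ℂ) * ∫ y : ℝ, ∑' n : ℕ, G n y := by
        rw [integral_tsum_of_summable_integral_norm hint hsumm]
    _ = _ := by
        congr 1
        refine integral_congr_ae (Eventually.of_forall fun y ↦ ?_)
        simp only [hG]
        rw [tsum_mul_right, LSeries]

end Literature.Analysis.Complex
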